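import Mathlib
import HarnessLib
import Summits.ResolutionOfSingularities.ResolutionOfSingularities.Theorems.HomologicalConductorPersistenceFrobeniusOrderSyzygy

/-!
# The cohomology annihilator of a Frobenius order IS the stable annihilator of its lattices, and is
# reached at level `d + 1`

Route `ResolutionOfSingularities/HomologicalConductor`, chain W4.4b (crux `Persistence`
stmt-ResolutionOfSingularities-16484, K-C3; rung S-2 stmt-19970 uses the level form at Gorenstein
arrivals).  [OURS · L1 w44b · res-D-pv-037 gen 9; AI-written and AI-reviewed only (weaker than expert
review); NOT a statement of the manuscript under study.]

`Theorems/HomologicalConductorPersistenceFrobeniusOrderSyzygy.lean` (p530841) proved ONE inclusion: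
over a noetherian Frobenius order `Λ/P` (dual bases `b`, `b∨` for a `P`-linear form `τ`), every element
of `ca(Λ)` stably annihilates every LATTICE (finitely generated `Λ`-module projective over `P`).  This file
proves the CONVERSE and the LEVEL statement, under the single extra hypothesis `caᵈ⁺¹(P) = P` (e.g. `P`
a polynomial ring in `d` variables over a field — the tree's
`cohomologyAnnihilatorOfDegree_mvPolynomial_eq_top`):

* `moduleProjective_restrictScalars` — projective over `Λ` and `Λ` projective over `P` ⇒ projective
  over `P`;
* `hasProjectiveDimensionLT_restrictScalars_of_isSyzygy` — along a syzygy chain over `Λ` the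
  `P`-projective dimension drops by one per step (the middles are `P`-projective);
* `moduleProjective_restrictScalars_of_isSyzygy` — hence, if `caᵈ⁺¹(P) = P` (every finitely generated
  `P`-module has projective dimension `≤ d`), every `d`-th syzygy over `Λ` of a finitely generated
  `Λ`-module is a LATTICE;
* **`mem_cohomologyAnnihilatorOfDegree_succ_of_forall_lattice`** — so an element stably annihilating
  every lattice lies in `caᵈ⁺¹(Λ)` (CA1 at level `d`);
* **`mem_cohomologyAnnihilator_iff_forall_lattice`**, **`mem_cohomologyAnnihilator_iff_mem_degree_succ`**,
  **`cohomologyAnnihilator_eq_cohomologyAnnihilatorOfDegree_succ`** — for a noetherian Frobenius order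
  `Λ` over `P` with `caᵈ⁺¹(P) = P`:
  `ca(Λ) = caᵈ⁺¹(Λ) = {x | x stably annihilates every lattice}` ("Esentepe's Lemma 2.3 and the
  stabilisation `caⁿ = caᵈ⁺¹ (n ≥ d+1)` for Frobenius orders", both directions, proved).

The K-C3 instance (`W₀ = k[a,b,c]^{μ₆}` over `P₀ = k[a⁶,b³,c²] ≅ k[A,B,C]`, `d = 3`: `ca(W₀) = ca⁴(W₀)`,
res-L1-w44b-tri-2's «all levels» claim in the kernel) is in `…KC3FrobeniusOrderLevel.lean`.
References (mechanism only): S. B. Iyengar, R. Takahashi, IMRN 2016 §2, Example 2.5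
[`IyengarTakahashi2014`]; Ö. Esentepe, arXiv:1807.05471 Lemma 2.3 [`Esentepe2018`].
-/

noncomputable section

-- single-problem summit: the doubled namespace component `ResolutionOfSingularities` is forced
set_option linter.dupNamespace false

namespace Summit.ResolutionOfSingularities.ResolutionOfSingularities.Theorems.HomologicalConductor.FrobeniusOrderSyzygy

open CategoryTheory Literature.RingTheory.CohomologyAnnihilator
open Summit.ResolutionOfSingularities.ResolutionOfSingularities.Theorems.NoZeno.SandwichCluster

universe u

section Level

variable {P Λ : Type u} [CommRing P] [CommRing Λ] [Algebra P Λ]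

/-! ## Restriction of scalars: projectivity and syzygy chains -/

/-- **Projective over `Λ` and `Λ` projective over `P` ⇒ projective over `P`** (a `Λ`-summand of a free
`Λ`-module is a `P`-summand of a `P`-projective module). [folklore] -/
theorem moduleProjective_restrictScalars [Module.Projective P Λ] (Q : Type u) [AddCommGroup Q]
    [Module Λ Q] [Module P Q] [IsScalarTower P Λ Q] [Module.Projective Λ Q] : Module.Projective P Q := by
  classical
  obtain ⟨s, hs⟩ := Module.projective_def'.mp ‹Module.Projective Λ Q›
  haveI : Module.Projective P (Q →₀ Λ) :=
    Module.Projective.of_equiv (finsuppLequivDFinsupp (M := Λ) (ι := Q) P).symm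
  exact Module.Projective.of_split (s.restrictScalars P)
    ((Finsupp.linearCombination Λ (id : Q → Q)).restrictScalars P)
    (by ext q; exact LinearMap.congr_fun hs q)

/-- The restricted module is a scalar tower `P → Λ → M`. [folklore] -/
theorem isScalarTower_restrictScalars (M : ModuleCat.{u} Λ) :
    IsScalarTower P Λ ((ModuleCat.restrictScalars (algebraMap P Λ)).obj M) :=
  IsScalarTower.of_algebraMap_smul fun _ _ => rfl

/-- Restriction of scalars of a finitely generated projective `Λ`-module is `P`-projective (in
`ModuleCat P`) when `Λ` is `P`-projective. [folklore] -/
theorem projective_restrictScalars [Module.Projective P Λ] (Q : ModuleCat.{u} Λ) (hQ : Projective Q) :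
    Projective ((ModuleCat.restrictScalars (algebraMap P Λ)).obj Q) := by
  haveI : Module.Projective Λ ((ModuleCat.restrictScalars (algebraMap P Λ)).obj Q) := moduleProjective_of_projective Q hQ
  haveI := isScalarTower_restrictScalars (P := P) Q
  haveI : Module.Projective P ((ModuleCat.restrictScalars (algebraMap P Λ)).obj Q) :=
    moduleProjective_restrictScalars (P := P) (Λ := Λ) ((ModuleCat.restrictScalars (algebraMap P Λ)).obj Q)
  exact (IsProjective.iff_projective (R := P) ((ModuleCat.restrictScalars (algebraMap P Λ)).obj Q)).mp inferInstance

/-- A short exact sequence in `ModuleCat Λ` restricts to a short exact sequence in `ModuleCat P`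
(same underlying maps). [folklore] -/
theorem shortExact_restrictScalars {K Q K' : ModuleCat.{u} Λ} {f : K ⟶ Q} {g : Q ⟶ K'} {w : f ≫ g = 0}
    (hS : (ShortComplex.mk f g w).ShortExact) :
    ∃ w' : (ModuleCat.restrictScalars (algebraMap P Λ)).map f ≫ (ModuleCat.restrictScalars (algebraMap P Λ)).map g = 0,
      (ShortComplex.mk ((ModuleCat.restrictScalars (algebraMap P Λ)).map f) ((ModuleCat.restrictScalars (algebraMap P Λ)).map g) w').ShortExact := by
  obtain ⟨hf, hg, hfg⟩ := shortExact_unpack hS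
  have w' : (ModuleCat.restrictScalars (algebraMap P Λ)).map f ≫ (ModuleCat.restrictScalars (algebraMap P Λ)).map g = 0 := by
    rw [← Functor.map_comp, w, Functor.map_zero]
  refine ⟨w', ?_⟩
  exact ModuleCat.shortComplex_shortExact _ hfg hf hg

/-- **Projective dimension over `P` along a syzygy chain over `Λ`**: if `K` is an `s`-th syzygy of `M`
over `Λ` (finitely generated projective middles) and `M|_P` has projective dimension `< n + 1 + s`,
then `K|_P` has projective dimension `< n + 1` (`Λ` projective over `P`, so the middles restrict to
projectives). [folklore; IyengarTakahashi2014 §2] -/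
theorem hasProjectiveDimensionLT_restrictScalars_of_isSyzygy [Module.Projective P Λ] :
    ∀ (s : ℕ) {M K : ModuleCat.{u} Λ}, IsSyzygy s M K → ∀ (n : ℕ),
      HasProjectiveDimensionLT ((ModuleCat.restrictScalars (algebraMap P Λ)).obj M) (n + 1 + s) →
        HasProjectiveDimensionLT ((ModuleCat.restrictScalars (algebraMap P Λ)).obj K) (n + 1)
  | 0, M, K, ⟨e⟩, n, h => by
    rw [Nat.add_zero] at h
    haveI := h
    exact hasProjectiveDimensionLT_of_iso ((ModuleCat.restrictScalars (algebraMap P Λ)).mapIso e.symm) (n + 1)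
  | s + 1, M, K, ⟨K', Q, hK', _, hQ, f, g, w, hS⟩, n, h => by
    have hK'pd : HasProjectiveDimensionLT ((ModuleCat.restrictScalars (algebraMap P Λ)).obj K') (n + 1 + 1) :=
      hasProjectiveDimensionLT_restrictScalars_of_isSyzygy s hK' (n + 1)
        (by rwa [show n + 1 + 1 + s = n + 1 + (s + 1) by ring])
    obtain ⟨w', hS'⟩ := shortExact_restrictScalars (P := P) hS
    haveI := projective_restrictScalars (P := P) Q hQ
    haveI : HasProjectiveDimensionLT ((ModuleCat.restrictScalars (algebraMap P Λ)).obj Q) (n + 1) :=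
      hasProjectiveDimensionLT_of_ge _ 1 _ (by omega)
    exact hS'.hasProjectiveDimensionLT_X₁ (n + 1) inferInstance hK'pd

/-- Over `P` with `caᵈ⁺¹(P) = P` (every finitely generated `P`-module has projective dimension `≤ d`),
a finitely generated `Λ`-module restricts to a `P`-module of projective dimension `< d + 1`
(`Λ` finite over `P`). [cite: IyengarTakahashi2014, Example 2.5] -/
theorem hasProjectiveDimensionLT_restrictScalars [IsNoetherianRing P] [Module.Finite P Λ] {d : ℕ}
    (hP : cohomologyAnnihilatorOfDegree P (d + 1) = ⊤) (M : ModuleCat.{u} Λ) [Module.Finite Λ M] :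
    HasProjectiveDimensionLT ((ModuleCat.restrictScalars (algebraMap P Λ)).obj M) (d + 1) := by
  haveI := isScalarTower_restrictScalars (P := P) M
  haveI : Module.Finite Λ ((ModuleCat.restrictScalars (algebraMap P Λ)).obj M) := (inferInstance : Module.Finite Λ M)
  haveI : Module.Finite P ((ModuleCat.restrictScalars (algebraMap P Λ)).obj M) := Module.Finite.trans Λ ((ModuleCat.restrictScalars (algebraMap P Λ)).obj M)
  exact hasProjectiveDimensionLT_of_cohomologyAnnihilatorOfDegree_eq_top hP _

/-- **`d`-th syzygies over `Λ` are LATTICES** when `caᵈ⁺¹(P) = P`: a `d`-th syzygy `K` of a finitely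
generated `Λ`-module is finitely generated over `Λ` and PROJECTIVE over `P` (dimension count
`d + 1 − d = 1`, then `HasProjectiveDimensionLT _ 1 ⇔ Projective`). [OURS · L1 w44b] -/
theorem moduleProjective_restrictScalars_of_isSyzygy [IsNoetherianRing P] [Module.Finite P Λ]
    [Module.Projective P Λ] {d : ℕ} (hP : cohomologyAnnihilatorOfDegree P (d + 1) = ⊤)
    {M K : ModuleCat.{u} Λ} [Module.Finite Λ M] (hK : IsSyzygy d M K) :
    Module.Projective P ((ModuleCat.restrictScalars (algebraMap P Λ)).obj K) := by
  have h : HasProjectiveDimensionLT ((ModuleCat.restrictScalars (algebraMap P Λ)).obj K) (0 + 1) :=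
    hasProjectiveDimensionLT_restrictScalars_of_isSyzygy d hK 0
      (by rw [Nat.zero_add, Nat.add_comm]; exact hasProjectiveDimensionLT_restrictScalars hP M)
  rw [Nat.zero_add] at h
  haveI : Projective ((ModuleCat.restrictScalars (algebraMap P Λ)).obj K) := projective_iff_hasProjectiveDimensionLT_one.mpr h
  exact moduleProjective_of_projective _ ‹_›

/-! ## The converse: stable annihilation of every lattice ⇒ membership in `caᵈ⁺¹(Λ)` -/

/-- **Stably annihilating every lattice puts `x` in `caᵈ⁺¹(Λ)`** (`Λ` noetherian, finite projective
over noetherian `P` with `caᵈ⁺¹(P) = P`): by CA1, `x ∈ caᵈ⁺¹(Λ)` iff `x` stably annihilates every `d`-th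
syzygy of every finitely generated module, and those are lattices. [OURS · L1 w44b] -/
theorem mem_cohomologyAnnihilatorOfDegree_succ_of_forall_lattice [IsNoetherianRing Λ]
    [IsNoetherianRing P] [Module.Finite P Λ] [Module.Projective P Λ] {d : ℕ}
    (hP : cohomologyAnnihilatorOfDegree P (d + 1) = ⊤) {x : Λ}
    (h : ∀ (L : Type u) [AddCommGroup L] [Module Λ L] [Module P L] [IsScalarTower P Λ L]
      [Module.Finite Λ L] [Module.Projective P L], StablyAnnihilates Λ x (ModuleCat.of Λ L)) :
    x ∈ cohomologyAnnihilatorOfDegree Λ (d + 1) := by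
  rw [mem_cohomologyAnnihilatorOfDegree_succ_iff_forall_isSyzygy]
  intro M K hM hK
  haveI := hM
  haveI : Module.Finite Λ ((ModuleCat.restrictScalars (algebraMap P Λ)).obj K) := finite_of_isSyzygy d hM hK
  haveI := isScalarTower_restrictScalars (P := P) K
  haveI : Module.Projective P ((ModuleCat.restrictScalars (algebraMap P Λ)).obj K) := moduleProjective_restrictScalars_of_isSyzygy hP hK
  exact h ((ModuleCat.restrictScalars (algebraMap P Λ)).obj K)

variable {ι : Type} [Fintype ι] {τ : Λ →ₗ[P] P} {b bd : ι → Λ}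

/-- **`ca(Λ)` = the stable annihilator of the lattice category** (noetherian Frobenius order `Λ` over
noetherian `P` with `caᵈ⁺¹(P) = P`, dual bases `b`, `b∨` for `τ`): `x ∈ ca(Λ)` iff `x` stably
annihilates every finitely generated `Λ`-module that is projective over `P`.  (`⇒` is p530841's
`stablyAnnihilates_of_mem_cohomologyAnnihilator_of_frobeniusOrder`; `⇐` the previous theorem.)
[OURS · L1 w44b; "Esentepe Lemma 2.3 for Frobenius orders", both directions] -/
theorem mem_cohomologyAnnihilator_iff_forall_lattice [IsNoetherianRing Λ] [IsNoetherianRing P]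
    [Module.Finite P Λ] [Module.Projective P Λ] {d : ℕ}
    (hP : cohomologyAnnihilatorOfDegree P (d + 1) = ⊤)
    (h₁ : ∀ y : Λ, ∑ i, τ (y * bd i) • b i = y) (h₂ : ∀ y : Λ, ∑ i, τ (y * b i) • bd i = y) {x : Λ} :
    x ∈ cohomologyAnnihilator Λ ↔
      ∀ (L : Type u) [AddCommGroup L] [Module Λ L] [Module P L] [IsScalarTower P Λ L]
        [Module.Finite Λ L] [Module.Projective P L], StablyAnnihilates Λ x (ModuleCat.of Λ L) :=
  ⟨fun hx L _ _ _ _ _ _ => stablyAnnihilates_of_mem_cohomologyAnnihilator_of_frobeniusOrder L h₁ h₂ hx,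
    fun h => cohomologyAnnihilatorOfDegree_le (d + 1)
      (mem_cohomologyAnnihilatorOfDegree_succ_of_forall_lattice hP h)⟩

/-- **`ca(Λ) = caᵈ⁺¹(Λ)` elementwise** under the same hypotheses. [OURS · L1 w44b] -/
theorem mem_cohomologyAnnihilator_iff_mem_degree_succ [IsNoetherianRing Λ] [IsNoetherianRing P]
    [Module.Finite P Λ] [Module.Projective P Λ] {d : ℕ}
    (hP : cohomologyAnnihilatorOfDegree P (d + 1) = ⊤)
    (h₁ : ∀ y : Λ, ∑ i, τ (y * bd i) • b i = y) (h₂ : ∀ y : Λ, ∑ i, τ (y * b i) • bd i = y) {x : Λ} :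
    x ∈ cohomologyAnnihilator Λ ↔ x ∈ cohomologyAnnihilatorOfDegree Λ (d + 1) :=
  ⟨fun hx => mem_cohomologyAnnihilatorOfDegree_succ_of_forall_lattice hP
      ((mem_cohomologyAnnihilator_iff_forall_lattice hP h₁ h₂).mp hx),
    fun hx => cohomologyAnnihilatorOfDegree_le (d + 1) hx⟩

/-- **The cohomology annihilator of a Frobenius order is reached at level `d + 1`**:
`ca(Λ) = caᵈ⁺¹(Λ)`, hence `caⁿ(Λ) = caᵈ⁺¹(Λ)` for all `n ≥ d + 1` — the stabilisation res-L1-w44b-tri-2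
used for `W = k[a,b,c]^{μ₆}` («`caⁿ(W) = ca⁴(W)` for every `n ≥ 4`»), proved for every noetherian
Frobenius order over a base with `caᵈ⁺¹(P) = P`. [OURS · L1 w44b] -/
theorem cohomologyAnnihilator_eq_cohomologyAnnihilatorOfDegree_succ [IsNoetherianRing Λ]
    [IsNoetherianRing P] [Module.Finite P Λ] [Module.Projective P Λ] {d : ℕ}
    (hP : cohomologyAnnihilatorOfDegree P (d + 1) = ⊤)
    (h₁ : ∀ y : Λ, ∑ i, τ (y * bd i) • b i = y) (h₂ : ∀ y : Λ, ∑ i, τ (y * b i) • bd i = y) :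
    cohomologyAnnihilator Λ = cohomologyAnnihilatorOfDegree Λ (d + 1) :=
  le_antisymm (fun _ hx => (mem_cohomologyAnnihilator_iff_mem_degree_succ hP h₁ h₂).mp hx)
    (cohomologyAnnihilatorOfDegree_le (d + 1))

/-- The level form: `caⁿ(Λ) = caᵈ⁺¹(Λ)` for every `n ≥ d + 1`. [OURS · L1 w44b] -/
theorem cohomologyAnnihilatorOfDegree_eq_of_le [IsNoetherianRing Λ] [IsNoetherianRing P]
    [Module.Finite P Λ] [Module.Projective P Λ] {d : ℕ}
    (hP : cohomologyAnnihilatorOfDegree P (d + 1) = ⊤)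
    (h₁ : ∀ y : Λ, ∑ i, τ (y * bd i) • b i = y) (h₂ : ∀ y : Λ, ∑ i, τ (y * b i) • bd i = y)
    {n : ℕ} (hn : d + 1 ≤ n) :
    cohomologyAnnihilatorOfDegree Λ n = cohomologyAnnihilatorOfDegree Λ (d + 1) :=
  le_antisymm ((cohomologyAnnihilatorOfDegree_le n).trans
      (cohomologyAnnihilator_eq_cohomologyAnnihilatorOfDegree_succ hP h₁ h₂).le)
    (cohomologyAnnihilatorOfDegree_mono hn)

/-- Basis form of `ca(Λ) = caᵈ⁺¹(Λ)` (two `P`-bases `b`, `b∨` with `τ(bᵢ b∨ⱼ) = δᵢⱼ`, res-D-pv-058's U15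
shape). [OURS · L1 w44b] -/
theorem cohomologyAnnihilator_eq_cohomologyAnnihilatorOfDegree_succ_basis [IsNoetherianRing Λ]
    [IsNoetherianRing P] [DecidableEq ι] {d : ℕ} (hP : cohomologyAnnihilatorOfDegree P (d + 1) = ⊤)
    (β βd : Module.Basis ι P Λ) (hG : ∀ i j, τ (β i * βd j) = if i = j then 1 else 0) :
    cohomologyAnnihilator Λ = cohomologyAnnihilatorOfDegree Λ (d + 1) := by
  haveI : Module.Finite P Λ := Module.Finite.of_basis β
  haveI : Module.Projective P Λ := Module.Projective.of_basis β
  obtain ⟨h₁, h₂⟩ := dualBases_of_basis (τ := τ) β βd hG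
  exact cohomologyAnnihilator_eq_cohomologyAnnihilatorOfDegree_succ hP h₁ h₂

end Level

end Summit.ResolutionOfSingularities.ResolutionOfSingularities.Theorems.HomologicalConductor.FrobeniusOrderSyzygy

end
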